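import Summits.AtomisticToContinuum.Crystallization.Theses.GappedShellCensus

/-!
# Crux `GappedShellCensus.CleanLimitExtractionR` (stmt-AtomisticToContinuum-18072), line
# `CleanLimitExtractionR_CandidateProof` — stub D `stub_cleRTrichotomyFactor`

THE NEW FACTOR OF THE REPAIRED BRIDGE: `ShellTrichotomy → TornFree → FiveFoldRationingR →`
pattern-typed rationing (an all-gapped-twelve non-empty `Y ⊆ ℝ³` has balls of every radius in
which every rescaled bond shell is `1/5`-close to fcc or hcp).  The whole content is bookkeeping:
`cleR_rescaledShell_hyps` (the rescaled shell of a gapped site with admissible shell, as a `Finset`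
satisfying the three typing hypotheses of `ShellTrichotomy`), `cleR_shellDegree_eq_commonNbrs`
(THE IDENTITY: shell-degree of the shell point `a⁻¹ • (v - y)` in the rescaled shell of `y` =
common-neighbour count of the bond `(y, v)`), `cleR_fccHcpShell_of_exactFour` (trichotomy + all
bonds exactly four ⇒ branch (A); branches (B) `≥ 5` and (C) `≤ 3` are excluded by the identity),
and the stub (TornFree `≥ 4` + FiveFoldRationingR `≤ 4` on balls ⇒ exactly four there).  The same
lemmas were attached by the crux refuter as `Bookkeeping.lean` (rc 0).
Ported from the checked crux workfile `Cruxes/CleanLimitExtractionR/SketchIdeator2.lean` (crux-ideate,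
ideator 2; farm rc 0, H21 audit `proof-of-item closed:true`); the route's clauses (gapped-twelve,
fcc/hcp-typed shell, clean site) are written out verbatim — no definitions, no notations.
-/

noncomputable section

namespace Summit.AtomisticToContinuum.Crystallization.Theorems

open Filter Topology Set
open scoped Classical
open Literature.Geometry.DiscreteGeometry
open Summit.AtomisticToContinuum.Crystallization.Theses.GappedShellCensus

/-- In an all-gapped-twelve configuration every shell is admissible (pair clause at the shell
points). -/
theorem cleR_shellAdmissible_of_forall_gapped {a : ℝ} {Y : Set (EuclideanSpace ℝ (Fin 3))}
    (hgood : ∀ y ∈ Y, ({w ∈ Y | w ≠ y ∧ dist y w ≤ a * (1 + 1 / 50)}.ncard = 12 ∧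
          ∀ w ∈ Y, w ≠ y → a * (1 - 1 / 50) ≤ dist y w ∧
            (dist y w ≤ a * (1 + 1 / 50) ∨ a * (63 / 50) ≤ dist y w))) (y : EuclideanSpace ℝ (Fin 3)) :
                (∀ w ∈ Y, w ≠ y → dist y w ≤ a * (1 + 1 / 50) → ∀ w' ∈ Y, w' ≠ y →
                    dist y w' ≤ a * (1 + 1 / 50) → w ≠ w' →
                      a * (1 - 1 / 50) ≤ dist w w' ∧ (dist w w' ≤ a * (1 + 1 / 50) ∨ a * (63 / 50) ≤ dist w w')) :=
  fun w hw _ _ w' hw' _ _ hww' => (hgood w hw).2 w' hw' (Ne.symm hww')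

/-- The rescaled bond shell of a gapped-twelve site with admissible shell, as a `Finset`
satisfying the three typing hypotheses of `ShellTrichotomy` (twelve points, radii in
`[0.98, 1.02]`, admissible mutual distances). -/
theorem cleR_rescaledShell_hyps {a : ℝ} (ha : 0 < a) {Y : Set (EuclideanSpace ℝ (Fin 3))} {y : EuclideanSpace ℝ (Fin 3)}
    (hg : ({w ∈ Y | w ≠ y ∧ dist y w ≤ a * (1 + 1 / 50)}.ncard = 12 ∧
          ∀ w ∈ Y, w ≠ y → a * (1 - 1 / 50) ≤ dist y w ∧
            (dist y w ≤ a * (1 + 1 / 50) ∨ a * (63 / 50) ≤ dist y w))) (hadm :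
                (∀ w ∈ Y, w ≠ y → dist y w ≤ a * (1 + 1 / 50) → ∀ w' ∈ Y, w' ≠ y →
                    dist y w' ≤ a * (1 + 1 / 50) → w ≠ w' →
                      a * (1 - 1 / 50) ≤ dist w w' ∧ (dist w w' ≤ a * (1 + 1 / 50) ∨ a * (63 / 50) ≤ dist w w'))) :
    ∃ T : Finset (EuclideanSpace ℝ (Fin 3)),
      (↑T : Set (EuclideanSpace ℝ (Fin 3))) = (fun w => a⁻¹ • (w - y)) '' {w ∈ Y | w ≠ y ∧ dist y w ≤ a * (1 + 1 / 50)} ∧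
      T.card = 12 ∧ (∀ v ∈ T, 1 - 1 / 50 ≤ ‖v‖ ∧ ‖v‖ ≤ 1 + 1 / 50) ∧
      (∀ v ∈ T, ∀ w ∈ T, v ≠ w → 1 - 1 / 50 ≤ dist v w ∧ (dist v w ≤ 1 + 1 / 50 ∨ 63 / 50 ≤ dist v w)) := by
  classical
  obtain ⟨hcount, hrad⟩ := hg
  have hresc_inj : Function.Injective fun w : EuclideanSpace ℝ (Fin 3) => a⁻¹ • (w - y) := fun u v huv =>
    sub_left_injective (smul_right_injective (EuclideanSpace ℝ (Fin 3)) (inv_ne_zero ha.ne') huv)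
  have hfin : {w ∈ Y | w ≠ y ∧ dist y w ≤ a * (1 + 1 / 50)}.Finite :=
    Set.finite_of_ncard_ne_zero (by rw [hcount]; norm_num)
  have hfinT := hfin.image (fun w => a⁻¹ • (w - y))
  refine ⟨hfinT.toFinset, hfinT.coe_toFinset, ?_, ?_, ?_⟩
  · rw [← Set.ncard_coe_finset, hfinT.coe_toFinset, Set.ncard_image_of_injective _ hresc_inj,
      hcount]
  · intro v hv
    rw [Set.Finite.mem_toFinset] at hv
    obtain ⟨w, ⟨hw, hwy, hd⟩, rfl⟩ := hv
    have hlo := (hrad w hw hwy).1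
    rw [norm_smul, norm_inv, Real.norm_of_nonneg ha.le, ← dist_eq_norm, dist_comm]
    constructor
    · rw [le_inv_mul_iff₀ ha]; linarith
    · rw [inv_mul_le_iff₀ ha]; linarith
  · intro v hv v' hv' hvv'
    rw [Set.Finite.mem_toFinset] at hv hv'
    obtain ⟨w, ⟨hw, hwy, hd⟩, rfl⟩ := hv
    obtain ⟨w', ⟨hw', hw'y, hd'⟩, rfl⟩ := hv'
    have hww' : w ≠ w' := fun h => hvv' (by rw [h])
    obtain ⟨h1, h2⟩ := hadm w hw hwy hd w' hw' hw'y hd' hww'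
    rw [dist_smul₀, norm_inv, Real.norm_of_nonneg ha.le, dist_sub_right]
    refine ⟨by rw [le_inv_mul_iff₀ ha]; linarith, ?_⟩
    rcases h2 with h | h
    · left; rw [inv_mul_le_iff₀ ha]; linarith
    · right; rw [le_inv_mul_iff₀ ha]; linarith

/-- THE BOOKKEEPING IDENTITY of the repair: the shell-degree of the shell point `a⁻¹ • (v - y)` in
the rescaled shell `T` of `y` (the quantity `ShellTrichotomy` branches on) equals the
common-neighbour count of the bond `(y, v)` (the quantity `TornFree` / `FiveFoldRationingR`
bound). -/
theorem cleR_shellDegree_eq_commonNbrs {a : ℝ} (ha : 0 < a) {Y : Set (EuclideanSpace ℝ (Fin 3))} {y : EuclideanSpace ℝ (Fin 3)} {T : Finset (EuclideanSpace ℝ (Fin 3))}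
    (hT : (↑T : Set (EuclideanSpace ℝ (Fin 3))) = (fun w => a⁻¹ • (w - y)) '' {w ∈ Y | w ≠ y ∧ dist y w ≤ a * (1 + 1 / 50)})
    {v : EuclideanSpace ℝ (Fin 3)} (_hv : v ∈ Y) (_hvy : v ≠ y) (_hdv : dist y v ≤ a * (1 + 1 / 50)) :
    (T.filter fun u => u ≠ a⁻¹ • (v - y) ∧ dist (a⁻¹ • (v - y)) u ≤ 1 + 1 / 50).card =
      {w ∈ Y | w ≠ y ∧ w ≠ v ∧ dist y w ≤ a * (1 + 1 / 50) ∧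
        dist v w ≤ a * (1 + 1 / 50)}.ncard := by
  have hresc_inj : Function.Injective fun w : EuclideanSpace ℝ (Fin 3) => a⁻¹ • (w - y) := fun u u' huu' =>
    sub_left_injective (smul_right_injective (EuclideanSpace ℝ (Fin 3)) (inv_ne_zero ha.ne') huu')
  have hdist : ∀ w : EuclideanSpace ℝ (Fin 3), dist (a⁻¹ • (v - y)) (a⁻¹ • (w - y)) = a⁻¹ * dist v w := fun w => by
    rw [dist_smul₀, norm_inv, Real.norm_of_nonneg ha.le, dist_sub_right]
  have h1 : (↑(T.filter fun u => u ≠ a⁻¹ • (v - y) ∧ dist (a⁻¹ • (v - y)) u ≤ 1 + 1 / 50) : Set (EuclideanSpace ℝ (Fin 3))) =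
      (fun w => a⁻¹ • (w - y)) ''
        {w ∈ Y | w ≠ y ∧ w ≠ v ∧ dist y w ≤ a * (1 + 1 / 50) ∧ dist v w ≤ a * (1 + 1 / 50)} := by
    apply Set.ext
    intro u
    constructor
    · intro hu
      obtain ⟨huT, hne, hdu⟩ := Finset.mem_filter.1 (Finset.mem_coe.1 hu)
      have huT' : u ∈ (↑T : Set (EuclideanSpace ℝ (Fin 3))) := Finset.mem_coe.2 huT
      rw [hT] at huT'
      obtain ⟨w, ⟨hw, hwy, hdw⟩, rfl⟩ := huT'
      have hdu' : dist (a⁻¹ • (v - y)) (a⁻¹ • (w - y)) ≤ 1 + 1 / 50 := hdu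
      refine ⟨w, ⟨hw, hwy, fun h => hne (by rw [h]), hdw, ?_⟩, rfl⟩
      rw [hdist w, inv_mul_le_iff₀ ha] at hdu'
      exact hdu'
    · rintro ⟨w, ⟨hw, hwy, hwv, hdw, hdvw⟩, rfl⟩
      have hwT : a⁻¹ • (w - y) ∈ (↑T : Set (EuclideanSpace ℝ (Fin 3))) := by rw [hT]; exact ⟨w, ⟨hw, hwy, hdw⟩, rfl⟩
      refine Finset.mem_coe.2 (Finset.mem_filter.2 ⟨Finset.mem_coe.1 hwT,
        fun h => hwv (hresc_inj h), ?_⟩)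
      show dist (a⁻¹ • (v - y)) (a⁻¹ • (w - y)) ≤ 1 + 1 / 50
      rw [hdist w, inv_mul_le_iff₀ ha]
      exact hdvw
  rw [← Set.ncard_coe_finset, h1, Set.ncard_image_of_injective _ hresc_inj]

/-- POINTWISE TYPING (the trichotomy applied at ONE site): a gapped-twelve site with admissible
shell all of whose bonds have exactly four common neighbours has an fcc- or hcp-close rescaled
shell — branches (B) `≥ 5` and (C) `≤ 3` of `ShellTrichotomy` are excluded by the bookkeeping
identity. -/
theorem cleR_fccHcpShell_of_exactFour (hST : ShellTrichotomy) {a : ℝ} (ha : 0 < a) {Y : Set (EuclideanSpace ℝ (Fin 3))}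
    {y : EuclideanSpace ℝ (Fin 3)} (hg : ({w ∈ Y | w ≠ y ∧ dist y w ≤ a * (1 + 1 / 50)}.ncard = 12 ∧
          ∀ w ∈ Y, w ≠ y → a * (1 - 1 / 50) ≤ dist y w ∧
            (dist y w ≤ a * (1 + 1 / 50) ∨ a * (63 / 50) ≤ dist y w))) (hadm :
                (∀ w ∈ Y, w ≠ y → dist y w ≤ a * (1 + 1 / 50) → ∀ w' ∈ Y, w' ≠ y →
                    dist y w' ≤ a * (1 + 1 / 50) → w ≠ w' →
                      a * (1 - 1 / 50) ≤ dist w w' ∧ (dist w w' ≤ a * (1 + 1 / 50) ∨ a * (63 / 50) ≤ dist w w'))) (h4 :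
                          (∀ v ∈ Y, v ≠ y → dist y v ≤ a * (1 + 1 / 50) →
                              {w ∈ Y | w ≠ y ∧ w ≠ v ∧ dist y w ≤ a * (1 + 1 / 50) ∧
                                dist v w ≤ a * (1 + 1 / 50)}.ncard = 4)) :
    (∃ T : Finset (EuclideanSpace ℝ (Fin 3)), (↑T : Set (EuclideanSpace ℝ (Fin 3))) =
            (fun w => a⁻¹ • (w - y)) '' {w ∈ Y | w ≠ y ∧ dist y w ≤ a * (1 + 1 / 50)} ∧
          (ShellCloseTo (1 / 5) T fccKissingPattern ∨ ShellCloseTo (1 / 5) T hcpKissingPattern)) := by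
  obtain ⟨T, hT, hcard, hnorm, hpair⟩ := cleR_rescaledShell_hyps ha hg hadm
  refine ⟨T, hT, ?_⟩
  rcases hST T hcard hnorm hpair with hA | hB | ⟨u, hu, h5⟩ | ⟨u, hu, h3⟩
  · exact Or.inl hA
  · exact Or.inr hB
  · exfalso
    have huT : u ∈ (↑T : Set (EuclideanSpace ℝ (Fin 3))) := Finset.mem_coe.2 hu
    rw [hT] at huT
    obtain ⟨v, ⟨hv, hvy, hdv⟩, rfl⟩ := huT
    have h5' : 5 ≤ (T.filter fun u => u ≠ a⁻¹ • (v - y) ∧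
        dist (a⁻¹ • (v - y)) u ≤ 1 + 1 / 50).card := h5
    rw [cleR_shellDegree_eq_commonNbrs ha hT hv hvy hdv, h4 v hv hvy hdv] at h5'
    omega
  · exfalso
    have huT : u ∈ (↑T : Set (EuclideanSpace ℝ (Fin 3))) := Finset.mem_coe.2 hu
    rw [hT] at huT
    obtain ⟨v, ⟨hv, hvy, hdv⟩, rfl⟩ := huT
    have h3' : (T.filter fun u => u ≠ a⁻¹ • (v - y) ∧
        dist (a⁻¹ • (v - y)) u ≤ 1 + 1 / 50).card ≤ 3 := h3
    rw [cleR_shellDegree_eq_commonNbrs ha hT hv hvy hdv, h4 v hv hvy hdv] at h3'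
    omega

/-- **Stub D — THE TRICHOTOMY FACTOR**: `ShellTrichotomy → TornFree → FiveFoldRationingR →`
pattern-typed rationing (an all-gapped-twelve non-empty `Y` has, for every `R`, a centre `c ∈ Y`
such that every site within `R` of `c` has a `1/5`-fcc/hcp-close rescaled shell).  TornFree gives
`≥ 4` common neighbours for every bond of the all-gapped `Y`, FiveFoldRationingR gives a centre `c`
with `≤ 4` for every bond within `R` of `c`; so every bond there has exactly four, every shell
there is admissible (all sites gapped), and the pointwise typing `cleR_fccHcpShell_of_exactFour`
applies. -/
theorem stub_cleRTrichotomyFactor (hST : ShellTrichotomy) (hTF : TornFree)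
    (hFFR : FiveFoldRationingR) : (∀ (Y : Set (EuclideanSpace ℝ (Fin 3))) (a : ℝ), 0 < a → Y.Nonempty →
          (∀ y ∈ Y, ({w ∈ Y | w ≠ y ∧ dist y w ≤ a * (1 + 1 / 50)}.ncard = 12 ∧
              ∀ w ∈ Y, w ≠ y → a * (1 - 1 / 50) ≤ dist y w ∧
                (dist y w ≤ a * (1 + 1 / 50) ∨ a * (63 / 50) ≤ dist y w))) →
          ∀ R : ℝ, ∃ c ∈ Y, ∀ y ∈ Y, dist y c ≤ R →
            (∃ T : Finset (EuclideanSpace ℝ (Fin 3)), (↑T : Set (EuclideanSpace ℝ (Fin 3))) =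
                (fun w => a⁻¹ • (w - y)) '' {w ∈ Y | w ≠ y ∧ dist y w ≤ a * (1 + 1 / 50)} ∧
              (ShellCloseTo (1 / 5) T fccKissingPattern ∨ ShellCloseTo (1 / 5) T hcpKissingPattern))) := by
  intro Y a ha hne hgood R
  have htf : ∀ y ∈ Y, ∀ v ∈ Y, v ≠ y → dist y v ≤ a * (1 + 1 / 50) →
      4 ≤ {w ∈ Y | w ≠ y ∧ w ≠ v ∧ dist y w ≤ a * (1 + 1 / 50) ∧
        dist v w ≤ a * (1 + 1 / 50)}.ncard :=
    hTF Y a ha hgood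
  obtain ⟨c, hc, hle⟩ := hFFR Y a ha hne hgood htf R
  refine ⟨c, hc, fun y hy hyc => ?_⟩
  refine cleR_fccHcpShell_of_exactFour hST ha (hgood y hy) (cleR_shellAdmissible_of_forall_gapped hgood y) ?_
  intro v hv hvy hdv
  exact le_antisymm (hle y hy hyc v hv hvy hdv) (htf y hy v hv hvy hdv)

end Summit.AtomisticToContinuum.Crystallization.Theorems

end
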